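import Summits.AnomalousDissipation.AnomalousDissipation.Theorems.DopplerClockLaminarStreaks
import Literature.Analysis.FunctionSpaces.TorusFourierCalculus
import Literature.Analysis.FluidPDE.LongTimeAveragePeriodic

/-!
# Route DopplerClock (AnomalousDissipation) — crux `QuadratureStressFloor`
# (stmt-AnomalousDissipation-18129), line `laminar-burst-shadowing`:
# the registered stub `stub_laminarCalibration`

Sorry-free discharge of the stub `stub_laminarCalibration` of the line `laminar-burst-shadowing`
(payload slug `Sketch`) for the crux
`Summit.AnomalousDissipation.AnomalousDissipation.Theses.DopplerClock.QuadratureStressFloor`: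
the LAMINAR CALIBRATION of the line. The inertia-limited streak array of the route item
`LaminarStreaks` (stmt-AnomalousDissipation-18132, landed as `dopplerClock_laminarStreaks_proof`),

`u_L = V e₂ + sin(2πm x₁) [a cos(2πn x₂) + b sin(2πn x₂)] e₀`, `a = Fνκ²/D`, `b = FV(2πn)/D`,
`D = V²(2πn)² + ν²κ⁴`, `κ² = (2π)²(m² + n²)` (`V, ν > 0`, `n ≥ 1`),

viewed as a steady space–time field, has

* `meanDissipation ν u_L = ν‖∇u_L‖₂² ≤ νκ²F² / (4V²(2πn)²)` (so it is `O(ν)`), and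
* `meanEnergy u_L = ‖u_L‖₂² ≤ V² + F² / (4V²(2πn)²)`.

**Proof.** Long-time averages of a constant-in-time observable are the constant
(`meanEnergy_eq_of_periodic`, `meanDissipation_eq_of_periodic` with period `1`), and on the smooth
slice the spectral and the pointwise squared gradient norms agree
(`Torus.gradNormSq_eq_toReal_eGradNormSq_holds`); hence `meanEnergy u_L = ∫‖u_L‖² = 2·E(u_L)`,
bounded by the energy clause of `dopplerClock_laminarStreaks_proof`, and
`meanDissipation ν u_L = ν‖∇u_L‖₂²`. For the gradient, write `u_L = V e₂ + W` with
`W = a Ψ_c + b Ψ_s` a smooth `Δ`-eigenfield, `ΔW = −κ²W` (`DopplerStreaks.sinCos_regular`,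
`DopplerWork.pattern_regular`); the constant drops out of every `∂ᵢ`, and Green's first identity on
`T³` (`Torus.integral_inner_laplacian_eq_neg_holds`; Evans 2010, App. C.2, Thm. 3) gives
`‖∇u_L‖₂² = ‖∇W‖₂² = −∫⟪W, ΔW⟫ = κ² ∫‖W‖² = κ² ∫ w²`, `w = sin(2πm x₁)(a cos + b sin)(2πn x₂)`,
and `∫ w² ≤ (a² + b²)/4` is `DopplerStreaks.integral_sq_profile_le`; finally
`a² + b² = F²/D ≤ F²/(V²(2πn)²)`.

No new definitions; the registered stub is the last theorem, verbatim signature. Nothing about the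
loud witnesses of the line (the core stub) or the energy-stability threshold is proved here.

References: C. R. Doering, C. Foias, *Energy dissipation in body-forced turbulence*, J. Fluid
Mech. 467 (2002), §2; C. Foias, O. Manley, R. Rosa, R. Temam, *Navier–Stokes Equations and
Turbulence*, CUP 2001, Ch. II §2; L. C. Evans, *Partial Differential Equations*, 2nd ed., AMS 2010,
App. C.2, Thm. 3.
-/

noncomputable section

-- `Summit.<Summit>.<Problem>` is the tree's mandated summit-side namespace (CONVENTIONS §2); for this
-- single-conjunct summit the two coincide, so the duplicate is deliberate.
set_option linter.dupNamespace false

open MeasureTheory Set Filter Topology UnitAddTorus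
open scoped InnerProductSpace RealInnerProductSpace

namespace Summit.AnomalousDissipation.AnomalousDissipation.Theorems

open Literature.Analysis.FluidPDE Literature.Analysis.FluidPDE.Torus
open Literature.Analysis.FunctionSpaces Literature.Analysis.FunctionSpaces.Torus

namespace LaminarCalibration

/-! ### Long-time means of steady fields -/

/-- **Mean energy of a steady field**: `⟨‖u‖₂²⟩ = ∫‖v‖²` for the constant-in-time field `t ↦ v`
(a `1`-periodic observable: `meanEnergy_eq_of_periodic`). [folklore] -/
theorem meanEnergy_steady {d : Type*} [Fintype d] (v : UnitAddTorus d → EuclideanSpace ℝ d) :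
    meanEnergy (fun _ : ℝ => v) = ∫ x, ‖v x‖ ^ 2 := by
  rw [meanEnergy_eq_of_periodic (τ := 1) (fun _ => rfl) one_pos]
  simp

/-- **Mean dissipation of a smooth steady field**: `⟨ν‖∇u‖₂²⟩ = ν‖∇v‖₂²` with the POINTWISE
squared gradient norm `Torus.gradNormSq` (`meanDissipation_eq_of_periodic` with period `1`, and
`Torus.gradNormSq_eq_toReal_eGradNormSq_holds` on the smooth slice). [folklore] -/
theorem meanDissipation_steady {d : Type*} [Fintype d] [DecidableEq d] (ν : ℝ)
    {v : UnitAddTorus d → EuclideanSpace ℝ d} (hv : IsSmooth v) :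
    meanDissipation ν (fun _ : ℝ => v) = ν * gradNormSq v := by
  rw [meanDissipation_eq_of_periodic (τ := 1) (fun _ => rfl) one_pos,
    gradNormSq_eq_toReal_eGradNormSq_holds hv]
  simp

/-! ### The squared gradient norm of a drifted eigenfield -/

/-- **Green's first identity for a drifted `Δ`-eigenfield.** If `W` is smooth on `T³` with
`ΔW = −λW`, then for every constant `c`, `‖∇(c + W)‖₂² = ‖∇W‖₂² = −∫⟪W, ΔW⟫ = λ ∫‖W‖²`
(`∂ᵢ c = 0`; `Torus.integral_inner_laplacian_eq_neg_holds`, Evans 2010, App. C.2, Thm. 3).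
[folklore] -/
theorem gradNormSq_const_add_eig {W : UnitAddTorus (Fin 3) → EuclideanSpace ℝ (Fin 3)} {lam : ℝ}
    (hW : IsSmooth W ∧ ∀ x, laplacian W x = -(lam • W x)) (c : EuclideanSpace ℝ (Fin 3)) :
    gradNormSq (fun x => c + W x) = lam * ∫ x, ‖W x‖ ^ 2 := by
  have hWs : IsSmooth W := hW.1
  have hW1 : IsContDiff 1 W := hWs.isContDiff (by simp)
  -- the constant drops out of every partial derivative
  have hP : ∀ (i : Fin 3) (x : UnitAddTorus (Fin 3)),
      partialDeriv i (fun y => c + W y) x = partialDeriv i W x := by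
    intro i x
    have h := congrFun (partialDeriv_add (isContDiff_const c) hW1 i) x
    have hc : partialDeriv i (fun _ : UnitAddTorus (Fin 3) => c) x = 0 := by
      simp [Torus.partialDeriv, Torus.lineDeriv]
    rw [Pi.add_apply, hc, zero_add] at h
    exact h
  -- Green's first identity `∫⟪W, ΔW⟫ = -∑ᵢ ∫‖∂ᵢW‖²` and `ΔW = -λW`
  have hibp : ∫ x, ⟪W x, laplacian W x⟫_ℝ = -∑ i, ∫ x, ‖partialDeriv i W x‖ ^ 2 :=
    integral_inner_laplacian_eq_neg_holds hWs
  have heig : ∫ x, ⟪W x, laplacian W x⟫_ℝ = -(lam * ∫ x, ‖W x‖ ^ 2) := by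
    simp_rw [hW.2, inner_neg_right, real_inner_smul_right, real_inner_self_eq_norm_sq]
    rw [integral_neg, integral_const_mul]
  unfold gradNormSq
  simp_rw [hP]
  rw [integral_finsetSum _ fun i _ => ((hWs.partialDeriv i).norm_sq).integrable]
  linarith

/-- **Squared gradient norm of the streak array**: for `n ≠ 0`,
`‖∇(V e₂ + w e₀)‖₂² ≤ (2π)²(m² + n²) · (a² + b²)/4` with
`w = sin(2πm x₁) (a cos(2πn x₂) + b sin(2πn x₂))`: the fluctuation `W = w e₀ = aΨ_c + bΨ_s` is a
smooth `Δ`-eigenfield with eigenvalue `4π²(m² + n²)` (`DopplerStreaks.sinCos_regular`,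
`DopplerWork.pattern_regular`), so `‖∇(V e₂ + W)‖₂² = 4π²(m² + n²) ∫ w²`
(`gradNormSq_const_add_eig`), and `∫ w² ≤ (a² + b²)/4` (`DopplerStreaks.integral_sq_profile_le`,
the translation `x₂ ↦ x₂ + 1/(4n)`). [folklore] -/
theorem gradNormSq_streaks_le (V a b : ℝ) (m : ℕ) {n : ℕ} (hn : n ≠ 0) :
    gradNormSq (fun x : UnitAddTorus (Fin 3) =>
        V • EuclideanSpace.single (2 : Fin 3) (1 : ℝ) +
          ((mFourier (Pi.single (1 : Fin 3) (m : ℤ)) x).im *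
              (a * (mFourier (Pi.single (2 : Fin 3) (n : ℤ)) x).re +
                b * (mFourier (Pi.single (2 : Fin 3) (n : ℤ)) x).im)) •
            EuclideanSpace.single (0 : Fin 3) (1 : ℝ)) ≤
      (2 * Real.pi) ^ 2 * ((m : ℝ) ^ 2 + (n : ℝ) ^ 2) * ((a ^ 2 + b ^ 2) / 4) := by
  obtain ⟨hc_s, -, hc_Δ⟩ := DopplerStreaks.sinCos_regular m n
  obtain ⟨hs_s, -, hs_Δ⟩ := DopplerWork.pattern_regular m n
  -- the fluctuation `W = a Ψ_c + b Ψ_s`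
  obtain ⟨W, hW⟩ : ∃ W : UnitAddTorus (Fin 3) → EuclideanSpace ℝ (Fin 3), W = fun y =>
      a • (((mFourier (Pi.single (1 : Fin 3) (m : ℤ)) y).im *
          (mFourier (Pi.single (2 : Fin 3) (n : ℤ)) y).re) • EuclideanSpace.single (0 : Fin 3) (1 : ℝ)) +
        b • (((mFourier (Pi.single (1 : Fin 3) (m : ℤ)) y).im *
          (mFourier (Pi.single (2 : Fin 3) (n : ℤ)) y).im) • EuclideanSpace.single (0 : Fin 3) (1 : ℝ)) :=
    ⟨_, rfl⟩
  have hWreg : IsSmooth W ∧ ∀ x, laplacian W x =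
      -((4 * Real.pi ^ 2 * ((m : ℝ) ^ 2 + (n : ℝ) ^ 2)) • W x) := by
    rw [hW]
    exact AcdcDesign.eig_add (AcdcDesign.eig_smul ⟨hc_s, hc_Δ⟩ a)
      (AcdcDesign.eig_smul ⟨hs_s, hs_Δ⟩ b)
  have hWx : ∀ x, W x = ((mFourier (Pi.single (1 : Fin 3) (m : ℤ)) x).im *
      (a * (mFourier (Pi.single (2 : Fin 3) (n : ℤ)) x).re +
        b * (mFourier (Pi.single (2 : Fin 3) (n : ℤ)) x).im)) •
      EuclideanSpace.single (0 : Fin 3) (1 : ℝ) := by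
    intro x
    rw [hW]
    simp only [smul_smul, ← add_smul]
    congr 1
    ring
  have huL : (fun x : UnitAddTorus (Fin 3) =>
      V • EuclideanSpace.single (2 : Fin 3) (1 : ℝ) +
        ((mFourier (Pi.single (1 : Fin 3) (m : ℤ)) x).im *
            (a * (mFourier (Pi.single (2 : Fin 3) (n : ℤ)) x).re +
              b * (mFourier (Pi.single (2 : Fin 3) (n : ℤ)) x).im)) •
          EuclideanSpace.single (0 : Fin 3) (1 : ℝ)) =
      fun x => V • EuclideanSpace.single (2 : Fin 3) (1 : ℝ) + W x := by
    funext x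
    rw [hWx]
  -- `‖W x‖² = w(x)²`
  have hnorm : ∀ x, ‖W x‖ ^ 2 = ((mFourier (Pi.single (1 : Fin 3) (m : ℤ)) x).im *
      (a * (mFourier (Pi.single (2 : Fin 3) (n : ℤ)) x).re +
        b * (mFourier (Pi.single (2 : Fin 3) (n : ℤ)) x).im)) ^ 2 := by
    intro x
    rw [hWx, norm_smul, PiLp.norm_single, norm_one, mul_one, Real.norm_eq_abs, sq_abs]
  -- `∫ w² ≤ (a² + b²)/4`
  have hll : (Pi.single (2 : Fin 3) (n : ℤ) + Pi.single (2 : Fin 3) (n : ℤ) : Fin 3 → ℤ) 2 ≠ 0 := by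
    simp
    omega
  have hkk : (Pi.single (1 : Fin 3) (m : ℤ) + Pi.single (1 : Fin 3) (m : ℤ) : Fin 3 → ℤ) 2 = 0 := by
    simp
  have hI := DopplerStreaks.integral_sq_profile_le (Pi.single (1 : Fin 3) (m : ℤ))
    (Pi.single (2 : Fin 3) (n : ℤ)) a b hll hkk
  have hκ : (0 : ℝ) ≤ 4 * Real.pi ^ 2 * ((m : ℝ) ^ 2 + (n : ℝ) ^ 2) := by positivity
  rw [huL, gradNormSq_const_add_eig hWreg]
  simp_rw [hnorm]
  calc 4 * Real.pi ^ 2 * ((m : ℝ) ^ 2 + (n : ℝ) ^ 2) *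
        ∫ x : UnitAddTorus (Fin 3), ((mFourier (Pi.single (1 : Fin 3) (m : ℤ)) x).im *
          (a * (mFourier (Pi.single (2 : Fin 3) (n : ℤ)) x).re +
            b * (mFourier (Pi.single (2 : Fin 3) (n : ℤ)) x).im)) ^ 2
      ≤ 4 * Real.pi ^ 2 * ((m : ℝ) ^ 2 + (n : ℝ) ^ 2) * ((a ^ 2 + b ^ 2) / 4) :=
        mul_le_mul_of_nonneg_left hI hκ
    _ = (2 * Real.pi) ^ 2 * ((m : ℝ) ^ 2 + (n : ℝ) ^ 2) * ((a ^ 2 + b ^ 2) / 4) := by ring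

/-- **The amplitudes of the streak array**: `a² + b² = F²/D ≤ F²/(V²(2πn)²)` for
`a = Fνκ²/D`, `b = FV(2πn)/D`, `D = V²(2πn)² + ν²κ⁴ > 0` (`V, ν > 0`, `n ≥ 1`). [folklore] -/
theorem amplitudes_sq_add_sq_le {F V ν : ℝ} {m n : ℕ} (hV : 0 < V) (hν : 0 < ν) (hn : 0 < n) :
    (F * ν * ((2 * Real.pi) ^ 2 * ((m : ℝ) ^ 2 + (n : ℝ) ^ 2)) /
          (V ^ 2 * (2 * Real.pi * n) ^ 2 +
            ν ^ 2 * ((2 * Real.pi) ^ 2 * ((m : ℝ) ^ 2 + (n : ℝ) ^ 2)) ^ 2)) ^ 2 +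
        (F * V * (2 * Real.pi * n) /
          (V ^ 2 * (2 * Real.pi * n) ^ 2 +
            ν ^ 2 * ((2 * Real.pi) ^ 2 * ((m : ℝ) ^ 2 + (n : ℝ) ^ 2)) ^ 2)) ^ 2 ≤
      F ^ 2 / (V ^ 2 * (2 * Real.pi * n) ^ 2) := by
  have hω : 0 < 2 * Real.pi * (n : ℝ) := by positivity
  have hD : 0 < V ^ 2 * (2 * Real.pi * n) ^ 2 +
      ν ^ 2 * ((2 * Real.pi) ^ 2 * ((m : ℝ) ^ 2 + (n : ℝ) ^ 2)) ^ 2 := by positivity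
  have hD' : V ^ 2 * (2 * Real.pi * n) ^ 2 +
      ν ^ 2 * ((2 * Real.pi) ^ 2 * ((m : ℝ) ^ 2 + (n : ℝ) ^ 2)) ^ 2 ≠ 0 := hD.ne'
  have hsum : (F * ν * ((2 * Real.pi) ^ 2 * ((m : ℝ) ^ 2 + (n : ℝ) ^ 2)) /
        (V ^ 2 * (2 * Real.pi * n) ^ 2 +
          ν ^ 2 * ((2 * Real.pi) ^ 2 * ((m : ℝ) ^ 2 + (n : ℝ) ^ 2)) ^ 2)) ^ 2 +
      (F * V * (2 * Real.pi * n) /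
        (V ^ 2 * (2 * Real.pi * n) ^ 2 +
          ν ^ 2 * ((2 * Real.pi) ^ 2 * ((m : ℝ) ^ 2 + (n : ℝ) ^ 2)) ^ 2)) ^ 2 =
      F ^ 2 / (V ^ 2 * (2 * Real.pi * n) ^ 2 +
        ν ^ 2 * ((2 * Real.pi) ^ 2 * ((m : ℝ) ^ 2 + (n : ℝ) ^ 2)) ^ 2) := by
    field_simp
    ring
  rw [hsum]
  exact div_le_div_of_nonneg_left (sq_nonneg F) (by positivity)
    (by nlinarith [sq_nonneg (ν * ((2 * Real.pi) ^ 2 * ((m : ℝ) ^ 2 + (n : ℝ) ^ 2)))])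

end LaminarCalibration

/-- **Registered stub `stub_laminarCalibration`** of the line `laminar-burst-shadowing` (crux
`DopplerClock.QuadratureStressFloor`, stmt-AnomalousDissipation-18129): the laminar streak array
`u_L(ν) = V e₂ + sin(2πm x₁)[a cos 2πn x₂ + b sin 2πn x₂] e₀`, `a = Fνκ²/D`, `b = FV(2πn)/D`,
`D = V²(2πn)² + ν²κ⁴`, `κ² = (2π)²(m²+n²)`, viewed as a steady space–time field, has
`meanDissipation ν u_L = ν‖∇u_L‖₂² ≤ νκ²F²/(4V²(2πn)²)` (`‖∇u_L‖₂² = κ² ∫w² ≤ κ²(a²+b²)/4`,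
`a² + b² = F²/D ≤ F²/(V²(2πn)²)`) and `meanEnergy u_L = 2·E(u_L) ≤ V² + F²/(4V²(2πn)²)` (the
energy clause of `dopplerClock_laminarStreaks_proof`); constant-in-time Cesàro means
(Doering–Foias 2002, §2). [folklore] -/
theorem stub_laminarCalibration :
    ∀ (F V ν : ℝ) (m n : ℕ) (uL : UnitAddTorus (Fin 3) → EuclideanSpace ℝ (Fin 3)), 0 < V → 0 < ν → 0 < n →
      uL = (fun (x : UnitAddTorus (Fin 3)) => V • EuclideanSpace.single (2 : Fin 3) (1 : ℝ) +
          ((UnitAddTorus.mFourier (Pi.single (1 : Fin 3) (m : ℤ)) x).im *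
            ((F * ν * ((2 * Real.pi) ^ 2 * ((m : ℝ) ^ 2 + (n : ℝ) ^ 2)) / (V ^ 2 * (2 * Real.pi * n) ^ 2 + ν ^ 2 * ((2 * Real.pi) ^ 2 * ((m : ℝ) ^ 2 + (n : ℝ) ^ 2)) ^ 2)) * (UnitAddTorus.mFourier (Pi.single (2 : Fin 3) (n : ℤ)) x).re +
              (F * V * (2 * Real.pi * n) / (V ^ 2 * (2 * Real.pi * n) ^ 2 + ν ^ 2 * ((2 * Real.pi) ^ 2 * ((m : ℝ) ^ 2 + (n : ℝ) ^ 2)) ^ 2)) * (UnitAddTorus.mFourier (Pi.single (2 : Fin 3) (n : ℤ)) x).im)) •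
            EuclideanSpace.single (0 : Fin 3) (1 : ℝ)) →
      Literature.Analysis.FluidPDE.meanDissipation ν (fun (_ : ℝ) => uL) ≤
          ν * ((2 * Real.pi) ^ 2 * ((m : ℝ) ^ 2 + (n : ℝ) ^ 2)) * F ^ 2 / (4 * (V ^ 2 * (2 * Real.pi * n) ^ 2)) ∧
        Literature.Analysis.FluidPDE.meanEnergy (fun (_ : ℝ) => uL) ≤
          V ^ 2 + F ^ 2 / (4 * V ^ 2 * (2 * Real.pi * n) ^ 2) := by
  intro F V ν m n uL hV hν hn huL
  have hn0 : n ≠ 0 := Nat.pos_iff_ne_zero.1 hn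
  obtain ⟨hNS, -, hKE⟩ := dopplerClock_laminarStreaks_proof F V ν m n hV hν hn
  subst huL
  have hsm := hNS.smooth_velocity.isSmooth_slice (Set.mem_univ (0 : ℝ))
  have hab := LaminarCalibration.amplitudes_sq_add_sq_le (F := F) (m := m) hV hν hn
  have hκ : (0 : ℝ) ≤ (2 * Real.pi) ^ 2 * ((m : ℝ) ^ 2 + (n : ℝ) ^ 2) := by positivity
  refine ⟨?_, ?_⟩
  · -- dissipation: `ν‖∇u_L‖₂² ≤ νκ²(a² + b²)/4 ≤ νκ²F²/(4V²(2πn)²)`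
    rw [LaminarCalibration.meanDissipation_steady ν hsm]
    calc ν * gradNormSq _
        ≤ ν * ((2 * Real.pi) ^ 2 * ((m : ℝ) ^ 2 + (n : ℝ) ^ 2) * (_ / 4)) :=
          mul_le_mul_of_nonneg_left (LaminarCalibration.gradNormSq_streaks_le V _ _ m hn0) hν.le
      _ ≤ ν * ((2 * Real.pi) ^ 2 * ((m : ℝ) ^ 2 + (n : ℝ) ^ 2) *
            (F ^ 2 / (V ^ 2 * (2 * Real.pi * n) ^ 2) / 4)) :=
          mul_le_mul_of_nonneg_left (mul_le_mul_of_nonneg_left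
            (div_le_div_of_nonneg_right hab (by norm_num)) hκ) hν.le
      _ = ν * ((2 * Real.pi) ^ 2 * ((m : ℝ) ^ 2 + (n : ℝ) ^ 2)) * F ^ 2 /
            (4 * (V ^ 2 * (2 * Real.pi * n) ^ 2)) := by ring
  · -- energy: `⟨‖u_L‖₂²⟩ = ∫‖u_L‖² = 2 E(u_L)`
    rw [LaminarCalibration.meanEnergy_steady]
    unfold kineticEnergy at hKE
    have h8 : F ^ 2 / (8 * V ^ 2 * (2 * Real.pi * n) ^ 2) =
        F ^ 2 / (4 * V ^ 2 * (2 * Real.pi * n) ^ 2) / 2 := by ring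
    rw [h8] at hKE
    linarith

end Summit.AnomalousDissipation.AnomalousDissipation.Theorems

end
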